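import Mathlib
import HarnessLib
import Summits.Ventures.LatticeQCDFlow.Exactness.IMHAcceptanceGeHalfESS

/-!
# LatticeQCDFlow / Scaling — the equilibrium HOLDING TIME of the flow sampler on a general space is
# `Θ(1/κ)`: `W₂/Z ≤ ∫ w/(1 − λ(b)) dμ ≤ 2·W₂/Z`, i.e. `1/κ ≤ E_π[1/a] ≤ 2/κ`

HONEST FRAMING: exact (Metropolis-corrected) sampling algorithms for lattice gauge theory;
figures of merit are autocorrelation/cost numbers at stated couplings and volumes; no
continuum-physics claim.

Venture `LatticeQCDFlow` (cell pub-lqcd), topic `Scaling`; FANOUT row 3 (`s0-u1-a`, S0-B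
implementation A, GEN-11).  NEW WORK of the cell (two one-line estimates over row 2's rejection
curve), not a published result; NO definition is introduced.  Setting and objects of row 2's
`Exactness/IMHAcceptanceGeHalfESS` / `Exactness/IMHRejectionCurve` (imported): a measure space
`(X, μ)`, an un-normalised target weight `w > 0` (`Z = ∫ w`), a model density `q > 0` (`∫ q = 1`),
`b = w/q`, `W₂ = ∫ b·w dμ < ∞`, the population ESS fraction `κ = Z²/W₂`, and the rejection curve
`λ = rejCurve μ w q` — `1 − λ(v)` is the probability that the exact flow-MCMC (independence
Metropolis) chain sitting at a state of importance weight `v` accepts its next proposal, so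
`1/(1 − λ(b(x)))` is the mean HOLDING TIME at `x` (expected number of proposals spent per move) and
`∫ w/(1 − λ(b)) dμ / Z = E_π[1/a]` is its equilibrium mean — for weight-blind observables this is
`τ_int + 1/2` (row 8's `Scoring/IMHWeightBlindTau`; the finite two-sided law is row 3's
`Scoring/IMHWeightBlindTauESS`).

* `one_sub_rejCurve_le_div` — `1 − λ(v) ≤ Z/v` (`∫ w/max(b, v) ≤ ∫ w/v`): a state of weight `v`
  accepts at most the fraction `Z/v` of its proposals;
* `holdingTime_integrand_le` — from row 2's per-state floor `1 − λ(v) ≥ Z²/(W₂ + vZ)`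
  (`one_sub_rejCurve_ge`): `w/(1 − λ(b)) ≤ w·(W₂ + bZ)/Z²`, whence `integrable_holdingTime`;
* **`holdingTime_ge`** — `W₂/Z ≤ ∫ w/(1 − λ(b)) dμ` (i.e. `E_π[1/a] ≥ W₂/Z² = 1/κ`);
* **`holdingTime_le`** — `∫ w/(1 − λ(b)) dμ ≤ 2·W₂/Z` (i.e. `E_π[1/a] ≤ 2/κ`);
* `holdingTime_mem_Icc` — both at once.
* (appended, GEN-11) `phi4Flow_holdingTime_mem_Icc` — the instance for row 2's lattice φ⁴ flow sampler
  (`gibbsWeight J λ`, any positive model density with `W₂ < ∞`).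

Reading (value-free): on any configuration space, at equilibrium the exact chain spends on average
between `1/κ` and `2/κ` flow proposals per accepted move, `κ` the population ESS fraction of the
importance weights — the mean holding time is the reweighting inefficiency `1/κ` within a factor `2`,
for every flow; neither the acceptance `ā` (which can stay near `1` while `κ → 0`, row 3's
`Scaling/AcceptanceEssNoCeiling`) nor the weight ceiling `sup b` (which can be astronomically larger)
is the right scale.  NOT CLAIMED: the general-space `τ_int` law for weight-blind observables (typed
on finite product spaces only); any `κ`, `ā` or holding time of ours; nothing re-scored.
-/

namespace Summit.Ventures.LatticeQCDFlow.Theory2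

open Real MeasureTheory Filter Set
open Summit.Ventures.LatticeQCDFlow.Exactness

variable {X : Type*} [MeasurableSpace X] {μ : Measure X} {w q : X → ℝ}

/-- **`1 − λ(v) ≤ Z/v`** (`v > 0`): `1 − λ(v) = ∫ w/max(b, v) dμ ≤ ∫ w/v dμ = Z/v`. [ours] -/
theorem one_sub_rejCurve_le_div (hw0 : ∀ t, 0 < w t) (hwm : Measurable w) (hwi : Integrable w μ)
    (hq0 : ∀ t, 0 < q t) (hqm : Measurable q) (hqi : Integrable q μ) (hq1 : ∫ z, q z ∂μ = 1)
    {v : ℝ} (hv : 0 < v) :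
    1 - rejCurve μ w q v ≤ (∫ z, w z ∂μ) / v := by
  rw [one_sub_rejCurve_eq_integral_inv_max hw0 hwm hq0 hqm hqi hq1 hv, ← integral_div]
  refine integral_mono_of_nonneg (Eventually.of_forall fun z => ?_) (hwi.div_const v)
    (Eventually.of_forall fun z => ?_)
  · exact div_nonneg (hw0 z).le (le_max_of_le_right hv.le)
  · exact div_le_div_of_nonneg_left (hw0 z).le hv (le_max_right _ _)

/-- **The holding-time integrand is dominated**: `w/(1 − λ(b)) ≤ w·(W₂ + bZ)/Z²` pointwise, from
row 2's per-state floor `1 − λ(b) ≥ Z²/(W₂ + bZ)`. [ours] -/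
theorem holdingTime_integrand_le (hw0 : ∀ t, 0 < w t) (hwm : Measurable w) (hwi : Integrable w μ)
    (hq0 : ∀ t, 0 < q t) (hqm : Measurable q) (hqi : Integrable q μ) (hq1 : ∫ z, q z ∂μ = 1)
    (hW₂ : Integrable (fun x => w x / q x * w x) μ) (x : X) :
    w x / (1 - rejCurve μ w q (w x / q x))
      ≤ w x * ((∫ z, w z / q z * w z ∂μ) + w x / q x * ∫ z, w z ∂μ) / (∫ z, w z ∂μ) ^ 2 := by
  have hZ : 0 < ∫ z, w z ∂μ := integral_pos_of_pos hw0 hwi hq1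
  have hb : 0 < w x / q x := div_pos (hw0 x) (hq0 x)
  have hW : 0 < ∫ z, w z / q z * w z ∂μ :=
    integral_pos_of_pos (fun z => mul_pos (div_pos (hw0 z) (hq0 z)) (hw0 z)) hW₂ hq1
  have hD : 0 < (∫ z, w z / q z * w z ∂μ) + w x / q x * ∫ z, w z ∂μ :=
    add_pos hW (mul_pos hb hZ)
  have hfloor := one_sub_rejCurve_ge hw0 hwm hwi hq0 hqm hqi hq1 hW₂ hb
  have hpos : 0 < (∫ z, w z ∂μ) ^ 2 / ((∫ z, w z / q z * w z ∂μ) + w x / q x * ∫ z, w z ∂μ) :=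
    div_pos (pow_pos hZ 2) hD
  calc w x / (1 - rejCurve μ w q (w x / q x))
      ≤ w x / ((∫ z, w z ∂μ) ^ 2 / ((∫ z, w z / q z * w z ∂μ) + w x / q x * ∫ z, w z ∂μ)) :=
        div_le_div_of_nonneg_left (hw0 x).le hpos hfloor
    _ = w x * ((∫ z, w z / q z * w z ∂μ) + w x / q x * ∫ z, w z ∂μ) / (∫ z, w z ∂μ) ^ 2 := by
        rw [div_div_eq_mul_div]

variable [SFinite μ]

/-- The holding-time integrand `w/(1 − λ(b))` is integrable when `W₂ < ∞`. [ours] -/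
theorem integrable_holdingTime (hw0 : ∀ t, 0 < w t) (hwm : Measurable w) (hwi : Integrable w μ)
    (hq0 : ∀ t, 0 < q t) (hqm : Measurable q) (hqi : Integrable q μ) (hq1 : ∫ z, q z ∂μ = 1)
    (hW₂ : Integrable (fun x => w x / q x * w x) μ) :
    Integrable (fun x => w x / (1 - rejCurve μ w q (w x / q x))) μ := by
  set Z : ℝ := ∫ z, w z ∂μ with hZdef
  set W : ℝ := ∫ z, w z / q z * w z ∂μ with hWdef
  have hbm : Measurable fun x => w x / q x := hwm.div hqm
  have hdom : Integrable (fun x => w x * (W + w x / q x * Z) / Z ^ 2) μ := by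
    have e : (fun x => w x * (W + w x / q x * Z) / Z ^ 2)
        = fun x => (W / Z ^ 2) * w x + (Z / Z ^ 2) * (w x / q x * w x) := by
      funext x; ring
    rw [e]
    exact (hwi.const_mul _).add (hW₂.const_mul _)
  refine Integrable.mono' hdom ((hwm.div (measurable_const.sub
    ((measurable_rejCurve hwm hqm).comp hbm))).aestronglyMeasurable) (Eventually.of_forall fun x => ?_)
  have hacc : 0 < 1 - rejCurve μ w q (w x / q x) :=
    sub_pos.2 (rejCurve_lt_one hw0 hwm hq0 hqm hqi hq1 (div_pos (hw0 x) (hq0 x)))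
  rw [Real.norm_eq_abs, abs_of_nonneg (div_nonneg (hw0 x).le hacc.le)]
  exact holdingTime_integrand_le hw0 hwm hwi hq0 hqm hqi hq1 hW₂ x

/-- **HOLDING-TIME FLOOR `∫ w/(1 − λ(b)) dμ ≥ W₂/Z`** (`E_π[1/a] ≥ 1/κ`): pointwise
`1 − λ(b) ≤ Z/b`, so `w/(1 − λ(b)) ≥ w·b/Z`. [ours] -/
theorem holdingTime_ge (hw0 : ∀ t, 0 < w t) (hwm : Measurable w) (hwi : Integrable w μ)
    (hq0 : ∀ t, 0 < q t) (hqm : Measurable q) (hqi : Integrable q μ) (hq1 : ∫ z, q z ∂μ = 1)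
    (hW₂ : Integrable (fun x => w x / q x * w x) μ) :
    (∫ z, w z / q z * w z ∂μ) / ∫ z, w z ∂μ ≤ ∫ x, w x / (1 - rejCurve μ w q (w x / q x)) ∂μ := by
  have hZ : 0 < ∫ z, w z ∂μ := integral_pos_of_pos hw0 hwi hq1
  rw [← integral_div]
  refine integral_mono (hW₂.div_const _) (integrable_holdingTime hw0 hwm hwi hq0 hqm hqi hq1 hW₂)
    fun x => ?_
  have hb : 0 < w x / q x := div_pos (hw0 x) (hq0 x)
  have hacc : 0 < 1 - rejCurve μ w q (w x / q x) :=
    sub_pos.2 (rejCurve_lt_one hw0 hwm hq0 hqm hqi hq1 hb)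
  have hle := one_sub_rejCurve_le_div hw0 hwm hwi hq0 hqm hqi hq1 hb
  -- `w b / Z = w / (Z/b) ≤ w / (1 − λ(b))`
  calc w x / q x * w x / ∫ z, w z ∂μ = w x / ((∫ z, w z ∂μ) / (w x / q x)) := by
        field_simp
    _ ≤ w x / (1 - rejCurve μ w q (w x / q x)) :=
        div_le_div_of_nonneg_left (hw0 x).le hacc hle

/-- **HOLDING-TIME CEILING `∫ w/(1 − λ(b)) dμ ≤ 2·W₂/Z`** (`E_π[1/a] ≤ 2/κ`): integrate the
domination `w/(1 − λ(b)) ≤ w·(W₂ + bZ)/Z²`. [ours] -/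
theorem holdingTime_le (hw0 : ∀ t, 0 < w t) (hwm : Measurable w) (hwi : Integrable w μ)
    (hq0 : ∀ t, 0 < q t) (hqm : Measurable q) (hqi : Integrable q μ) (hq1 : ∫ z, q z ∂μ = 1)
    (hW₂ : Integrable (fun x => w x / q x * w x) μ) :
    ∫ x, w x / (1 - rejCurve μ w q (w x / q x)) ∂μ
      ≤ 2 * (∫ z, w z / q z * w z ∂μ) / ∫ z, w z ∂μ := by
  set Z : ℝ := ∫ z, w z ∂μ with hZdef
  set W : ℝ := ∫ z, w z / q z * w z ∂μ with hWdef
  have hZ : 0 < Z := integral_pos_of_pos hw0 hwi hq1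
  have hdom : Integrable (fun x => w x * (W + w x / q x * Z) / Z ^ 2) μ := by
    have e : (fun x => w x * (W + w x / q x * Z) / Z ^ 2)
        = fun x => (W / Z ^ 2) * w x + (Z / Z ^ 2) * (w x / q x * w x) := by
      funext x; ring
    rw [e]
    exact (hwi.const_mul _).add (hW₂.const_mul _)
  have hval : ∫ x, w x * (W + w x / q x * Z) / Z ^ 2 ∂μ = 2 * W / Z := by
    have e : ∀ x, w x * (W + w x / q x * Z) / Z ^ 2
        = (W / Z ^ 2) * w x + (Z / Z ^ 2) * (w x / q x * w x) := fun x => by ring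
    simp_rw [e]
    rw [integral_add (hwi.const_mul _) (hW₂.const_mul _), integral_const_mul, integral_const_mul,
      ← hZdef, ← hWdef]
    field_simp
    ring
  rw [← hval]
  exact integral_mono (integrable_holdingTime hw0 hwm hwi hq0 hqm hqi hq1 hW₂) hdom
    (fun x => holdingTime_integrand_le hw0 hwm hwi hq0 hqm hqi hq1 hW₂ x)

/-- **The two-sided holding-time law** `∫ w/(1 − λ(b)) dμ ∈ [W₂/Z, 2W₂/Z]`: with `Z = 1`,
`E_π[1/a] ∈ [1/κ, 2/κ]`. [ours] -/
theorem holdingTime_mem_Icc (hw0 : ∀ t, 0 < w t) (hwm : Measurable w) (hwi : Integrable w μ)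
    (hq0 : ∀ t, 0 < q t) (hqm : Measurable q) (hqi : Integrable q μ) (hq1 : ∫ z, q z ∂μ = 1)
    (hW₂ : Integrable (fun x => w x / q x * w x) μ) :
    ∫ x, w x / (1 - rejCurve μ w q (w x / q x)) ∂μ
      ∈ Icc ((∫ z, w z / q z * w z ∂μ) / ∫ z, w z ∂μ) (2 * (∫ z, w z / q z * w z ∂μ) / ∫ z, w z ∂μ) :=
  ⟨holdingTime_ge hw0 hwm hwi hq0 hqm hqi hq1 hW₂, holdingTime_le hw0 hwm hwi hq0 hqm hqi hq1 hW₂⟩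


/-! ### Appended (GEN-11): row 2's lattice φ⁴ flow sampler -/

section Lattice

open Summit.Ventures.LatticeQCDFlow.Scoring

variable {n : ℕ}

/-- **HOLDING TIME OF THE φ⁴ FLOW SAMPLER**: for every `λ > 0`, real `J`, positive measurable model
density `q̃` with `∫ q̃ = 1` and `W₂ = ∫ (e^{−S}/q̃)·e^{−S} < ∞` (`Z = ∫ e^{−S}`): the equilibrium mean
holding time satisfies `W₂/Z ≤ ∫ e^{−S}/(1 − λ(e^{−S}/q̃)) dφ ≤ 2·W₂/Z`, i.e. `E_π[1/a] ∈ [1/κ, 2/κ]`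
with `κ = Z²/W₂` the population ESS fraction. [ours] -/
theorem phi4Flow_holdingTime_mem_Icc {lam : ℝ} (hlam : 0 < lam)
    (J : Fin (n + 1) → Fin (n + 1) → ℝ) {q : (Fin (n + 1) → ℝ) → ℝ} (hq0 : ∀ φ, 0 < q φ)
    (hqm : Measurable q) (hqi : Integrable q) (hq1 : ∫ φ, q φ = 1)
    (hW₂ : Integrable (fun φ => gibbsWeight J lam φ / q φ * gibbsWeight J lam φ)) :
    ∫ φ, gibbsWeight J lam φ / (1 - rejCurve volume (gibbsWeight J lam) q (gibbsWeight J lam φ / q φ))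
      ∈ Icc ((∫ φ, gibbsWeight J lam φ / q φ * gibbsWeight J lam φ) / ∫ φ, gibbsWeight J lam φ)
        (2 * (∫ φ, gibbsWeight J lam φ / q φ * gibbsWeight J lam φ) / ∫ φ, gibbsWeight J lam φ) :=
  holdingTime_mem_Icc (μ := volume) (fun ψ => gibbsWeight_pos J lam ψ)
    (continuous_gibbsWeight J lam).measurable (integrable_gibbsWeight hlam J) hq0 hqm hqi hq1 hW₂

end Lattice

end Summit.Ventures.LatticeQCDFlow.Theory2
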